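import Mathlib.Topology.Order.IntermediateValue
import Literature.Geometry.Lorentzian.TimelikeShadow
import Literature.Geometry.Lorentzian.GeodesicProofs
import HarnessLib

/-!
# Null geodesics: propagation of the causal character, and completeness to the future from the
# absence of future-incomplete null geodesics

Two elementary facts about the geodesics of the Levi-Civita connection of a time-oriented
Lorentzian manifold `(M, g, τ)` (Hausdorff, without boundary, `Cⁿ` metric with `n ≥ 2`), used in
the geodesic half of Penrose's singularity theorem (Hawking–Ellis 1973, §8.1–8.2; O'Neill 1983,
Ch. 14, Prop. 60 / Thm. 61, hypothesis "`M` is future null complete"):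

* `IsGeodesicOn.velocity_ne_zero` — a geodesic with a nonzero velocity somewhere has nonzero
  velocity everywhere on its (open interval) domain (uniqueness of geodesics versus the constant
  geodesic; O'Neill 1983, Ch. 3, Lemma 22 and p. 69);
* `IsGeodesicOn.isNull_and_isFutureDirected_velocity` — **a future-directed null velocity
  propagates along a geodesic**: `g(γ', γ')` is constant (O'Neill Ch. 3, p. 69), `γ' ≠ 0`, and the
  continuous nowhere-vanishing function `t ↦ g(T, γ')` keeps its sign (a causal vector is never
  orthogonal to a timelike one, O'Neill Ch. 5, Lemma 5.26) — the null twin of the tree's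
  `IsGeodesicOn.isTimelike_and_isFutureDirected_velocity` (`TimelikeShadow.lean`);
* `Ici_subset_maximalGeodesicDomain_of_not_isFutureNullGeodesicallyIncomplete` — **if `(M, g, τ)`
  is not future null geodesically incomplete** (`¬ IsFutureNullGeodesicallyIncomplete τ`, the
  negation of the conclusion of the singularity theorems) **then every future-directed null
  vector `v` launches a maximal geodesic `γ_v` defined on all of `[0, ∞)`** (O'Neill's "future
  null complete", Ch. 14, p. 435): otherwise the domain of `γ_v` is bounded above and, by the
  previous item, `γ_v` is a future-incomplete future-directed null geodesic.

Everything is proved; no definitions and no named facts are introduced.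

## References

* B. O'Neill, *Semi-Riemannian geometry with applications to relativity*, Academic Press 1983,
  Ch. 3, Lemma 22 and p. 69; Ch. 5, Lemma 5.26 (p. 141); Ch. 14, p. 435 (future null complete).
* S. W. Hawking, G. F. R. Ellis, *The large scale structure of space-time*, CUP 1973, §8.1
  (pp. 256–258).
-/

noncomputable section

open Bundle Set Filter
open scoped Manifold ContDiff Topology

namespace Literature.Geometry.Lorentzian

variable {E : Type*} [NormedAddCommGroup E] [NormedSpace ℝ E] {H : Type*} [TopologicalSpace H]
  {I : ModelWithCorners ℝ E H} {M : Type*} [TopologicalSpace M] [ChartedSpace H M]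
  [IsManifold I ∞ M] [FiniteDimensional ℝ E]

/-! ### Nonvanishing of the velocity along a geodesic -/

/-- **A geodesic whose velocity is nonzero at one parameter has nonzero velocity at every
parameter of its (open interval) domain** (`C¹` connection, Hausdorff manifold without boundary):
if `γ' t = 0` then `γ` agrees on the interval with the constant geodesic through `γ t`
(uniqueness, O'Neill 1983, Ch. 3, Lemma 22; the tree's `IsGeodesicOn.eqOn_of_velocity_eq_holds`,
`isGeodesic_const_holds`), whose velocity vanishes identically. [cite: ONeillSemiRiemannian1983, Ch. 3, Lemma 22 and p. 69] -/
theorem IsGeodesicOn.velocity_ne_zero [CompleteSpace E] [T2Space M] [BoundarylessManifold I M]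
    {cov : CovariantDerivative I E (TangentSpace I : M → Type _)}
    [CovariantDerivative.ContMDiffCovariantDerivative cov 1] {γ : ℝ → M} {s : Set ℝ}
    (hs : IsOpen s) (hsc : s.OrdConnected) (hγ : IsGeodesicOn cov γ s) {t₀ : ℝ} (ht₀ : t₀ ∈ s)
    (h₀ : velocity I γ t₀ ≠ 0) {t : ℝ} (ht : t ∈ s) : velocity I γ t ≠ 0 := by
  intro hzero
  have hc : IsGeodesicOn cov (fun _ : ℝ ↦ γ t) s := (isGeodesic_const_holds cov (γ t)).isGeodesicOn s
  have hvc : velocity I (fun _ : ℝ ↦ γ t) t = 0 :=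
    Literature.Geometry.Riemannian.velocity_const (I := I) (γ t) t
  have heq : EqOn γ (fun _ : ℝ ↦ γ t) s :=
    IsGeodesicOn.eqOn_of_velocity_eq_holds hs hsc hγ hc ht rfl (by rw [hzero, hvc])
  have hev : γ =ᶠ[𝓝 t₀] fun _ : ℝ ↦ γ t :=
    Filter.eventuallyEq_of_mem (hs.mem_nhds ht₀) heq
  have hd : mfderiv 𝓘(ℝ, ℝ) I γ t₀ = mfderiv 𝓘(ℝ, ℝ) I (fun _ : ℝ ↦ γ t) t₀ := hev.mfderiv_eq
  have h1 : velocity I (fun _ : ℝ ↦ γ t) t₀ = 0 :=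
    Literature.Geometry.Riemannian.velocity_const (I := I) (γ t) t₀
  apply h₀
  change (mfderiv 𝓘(ℝ, ℝ) I γ t₀ : ℝ →L[ℝ] E) 1 = (0 : E)
  rw [hd]
  exact h1

/-! ### A future-directed null velocity propagates along a geodesic -/

namespace LorentzianMetric

variable {n : ℕ∞ω} (g : LorentzianMetric I n M)

/-- **Future-directed null velocity propagates along a geodesic.** Along a geodesic `γ` of the
Levi-Civita connection of `g` on an open interval `s` (Hausdorff manifold without boundary, `C¹`
Levi-Civita connection), if `γ' t₀` is null and future-directed for some `t₀ ∈ s` then so is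
`γ' t` for every `t ∈ s`: `g(γ', γ')` is constant along a geodesic (O'Neill 1983, Ch. 3, p. 69;
the tree's `val_velocity_eq_of_isGeodesicOn_holds`), `γ'` vanishes nowhere
(`IsGeodesicOn.velocity_ne_zero`), and the continuous function `t ↦ g(T_{γ t}, γ' t)` (product
rule along `γ`, `hasDerivAt_val_apply_along`) never vanishes on `s` — a causal vector is never
orthogonal to a timelike one (O'Neill Ch. 5, Lemma 5.26) — so it keeps its sign (intermediate
value theorem). Null twin of `IsGeodesicOn.isTimelike_and_isFutureDirected_velocity`.
[cite: ONeillSemiRiemannian1983, Ch. 3, p. 69 and Ch. 5, Lemma 5.26 (p. 141)] -/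
theorem _root_.Literature.Geometry.Lorentzian.IsGeodesicOn.isNull_and_isFutureDirected_velocity
    [CompleteSpace E] [T2Space M] [BoundarylessManifold I M] [Fact (1 ≤ n)] [g.HasLeviCivita]
    [CovariantDerivative.ContMDiffCovariantDerivative g.leviCivita 1]
    (τ : TimeOrientation g) {γ : ℝ → M} {s : Set ℝ}
    (hs : IsOpen s) (hsc : s.OrdConnected) (hγ : IsGeodesicOn g.leviCivita γ s) {t₀ : ℝ}
    (ht₀ : t₀ ∈ s) (h₀ : g.IsNull (velocity I γ t₀))
    (h₀' : τ.IsFutureDirected (velocity I γ t₀)) {t : ℝ} (ht : t ∈ s) :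
    g.IsNull (velocity I γ t) ∧ τ.IsFutureDirected (velocity I γ t) := by
  -- every velocity on `s` is null: `g(γ', γ')` is constant and `γ'` vanishes nowhere
  have hnull : ∀ u ∈ s, g.IsNull (velocity I γ u) := fun u hu ↦ by
    refine ⟨?_, hγ.velocity_ne_zero hs hsc ht₀ h₀.2 hu⟩
    rw [g.val_velocity_eq_of_isGeodesicOn_holds hs hsc hγ hu ht₀]
    exact h₀.1
  -- the pairing with the orienting field, a continuous nowhere-vanishing function on `s`
  set f : ℝ → ℝ := fun u ↦ g.val (γ u) (τ.vectorField (γ u)) (velocity I γ u) with hf_def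
  have hcompat : g.IsCompatible g.leviCivita :=
    (PseudoRiemannianMetric.isLeviCivita_leviCivita_holds (g := g.toPseudoRiemannianMetric)).2
  have hn : n ≠ 0 := (lt_of_lt_of_le zero_lt_one (Fact.out : (1 : ℕ∞ω) ≤ n)).ne'
  have hfc : ∀ u ∈ s, ContinuousAt f u := fun u hu ↦ by
    have hγu : MDifferentiableAt 𝓘(ℝ, ℝ) I γ u := IsGeodesicOn.mdifferentiableAt_holds hγ hu
    have hV : MDifferentiableAt 𝓘(ℝ, ℝ) I.tangent
        (fun u ↦ (TotalSpace.mk' E (γ u) (τ.vectorField (γ u)) : TangentBundle I M)) u :=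
      (τ.contMDiff.mdifferentiableAt hn).comp u hγu
    exact (g.hasDerivAt_val_apply_along hcompat (V := fun u ↦ τ.vectorField (γ u))
      (W := fun u ↦ velocity I γ u) hV (hγ.1 u hu)).continuousAt
  have hf0 : ∀ u ∈ s, f u ≠ 0 := fun u hu ↦
    g.val_ne_zero_of_isTimelike_of_isCausal (τ.isTimelike (γ u)) (hnull u hu).isCausal
  -- sign at `t₀` is negative; by the intermediate value theorem it stays negative on `s`
  have hft₀ : f t₀ < 0 := h₀'.2
  have hft : f t < 0 := by
    by_contra hcon
    have hle : 0 ≤ f t := not_lt.mp hcon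
    have hI : uIcc t₀ t ⊆ s := hsc.uIcc_subset ht₀ ht
    have hcont : ContinuousOn f (uIcc t₀ t) := fun u hu ↦ (hfc u (hI hu)).continuousWithinAt
    have hmem : (0 : ℝ) ∈ uIcc (f t₀) (f t) := mem_uIcc.2 (Or.inl ⟨hft₀.le, hle⟩)
    obtain ⟨c, hc, hfc0⟩ := intermediate_value_uIcc hcont hmem
    exact hf0 c (hI hc) hfc0
  exact ⟨hnull t ht, (hnull t ht).isCausal, hft⟩

/-! ### Future null completeness from the absence of future-incomplete null geodesics -/

variable {g}

/-- **No future-incomplete null geodesic ⇒ the maximal geodesic of every future-directed null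
vector is defined on `[0, ∞)`** (O'Neill 1983, Ch. 14, p. 435: "`M` is future null complete";
Hawking–Ellis 1973, §8.1). On a Hausdorff manifold without boundary with `C¹` Levi-Civita
connection: the maximal geodesic `γ_v` (`Literature.Geometry.Riemannian.maximalGeodesic`) has
future-directed null velocity throughout its domain
(`IsGeodesicOn.isNull_and_isFutureDirected_velocity`), so if that domain were bounded above `γ_v`
would witness `IsFutureNullGeodesicallyIncomplete τ`; an interval containing `0` and unbounded
above contains `[0, ∞)`. [cite: ONeillSemiRiemannian1983, Ch. 14, p. 435] -/
theorem Ici_subset_maximalGeodesicDomain_of_not_isFutureNullGeodesicallyIncomplete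
    [T2Space M] [BoundarylessManifold I M] [Fact (1 ≤ n)] [g.HasLeviCivita]
    [CovariantDerivative.ContMDiffCovariantDerivative g.leviCivita 1] {τ : TimeOrientation g}
    (h : ¬ IsFutureNullGeodesicallyIncomplete τ) {x : M} {v : TangentSpace I x}
    (hv : g.IsNull v) (hv' : τ.IsFutureDirected v) :
    Ici (0 : ℝ) ⊆ Literature.Geometry.Riemannian.maximalGeodesicDomain g.leviCivita x v := by
  haveI : CompleteSpace E := FiniteDimensional.complete ℝ E
  obtain ⟨hm, h0, hx, hvel⟩ := Literature.Geometry.Riemannian.maximalGeodesic_spec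
    (Literature.Geometry.Riemannian.hasMaximalGeodesic (cov := g.leviCivita) x v)
  set γ := Literature.Geometry.Riemannian.maximalGeodesic g.leviCivita x v with hγ_def
  set s := Literature.Geometry.Riemannian.maximalGeodesicDomain g.leviCivita x v with hs_def
  have h₀ : g.IsNull (velocity I γ 0) := by rw [hvel, hx]; exact hv
  have h₀' : τ.IsFutureDirected (velocity I γ 0) := by rw [hvel, hx]; exact hv'
  have hnb : ¬ BddAbove s := fun hb ↦ h ⟨γ, s, hm, ⟨0, h0⟩, hb, fun t ht ↦
    hm.isGeodesicOn.isNull_and_isFutureDirected_velocity g τ hm.isOpen hm.2.1 h0 h₀ h₀' ht⟩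
  intro t ht
  obtain ⟨t', ht's, htt'⟩ := not_bddAbove_iff.1 hnb t
  exact hm.2.1.out h0 ht's ⟨ht, htt'.le⟩

end LorentzianMetric

end Literature.Geometry.Lorentzian

end
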